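import Summits.AtomisticToContinuum.Crystallization.Theorems.FrustratedLawDichotomyLocalCloseOrderUniform
import Literature.MathematicalPhysics.StatisticalMechanics.LennardJonesClusters

/-!
# FrustratedLawDichotomy · crux `AperiodicFrustratedLawGap` (stmt-AtomisticToContinuum-27623) — UNDER `LCO`, CLOSE-PACKED SITES HAVE
# POSITIVE DENSITY IN EVERY EXACT μ-EQUILIBRIUM (decomp-a2c, prover hand 2, structural share, generation 7; route-independent module)

`FrustratedLawDichotomyLocalCloseOrderUniform.localCloseOrder_relDense`: under `LCO` there is one `k : ℕ` such that in every `7/10`-separated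
`e⋆`-μGSC of `V_LJ` every atom has a robustly good atom within distance `k` (uniform margins `η + 1/(k+1) ≤ 1/20`, `γ ≥ 1/(k+1)`).  Packing
(`Literature…card_le_of_separated_of_dist_le`: a `7/10`-separated set has at most `(20k/7 + 1)³ ≤ (3k+1)³` points in a ball of radius `k`)
turns relative density into DENSITY:

* `localCloseOrder_density` : `LCO → ∃ k`, for every `7/10`-separated `e⋆`-μGSC `X` and every finite set `s` of its atoms there is a finite
  set `G` of robustly good atoms of `X` (uniform margins), each within `k` of some atom of `s`, with `#s ≤ (3k+1)³ · #G`.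

So the frequency of close-packed sites in any exact Lennard-Jones μ-equilibrium is at least `(3k+1)⁻³ > 0` at every location and scale — the
configuration-level form of the «positive Palm frequency» half of hand-1's frequency × price reading, here DERIVED from the mere existence
statement `LCO` by compactness.  `[folklore]` bookkeeping.
-/

noncomputable section

namespace Summit.AtomisticToContinuum.Crystallization.Theorems.FrustratedLawDichotomyLocalCloseOrderDensity

open Metric
open Literature.MathematicalPhysics.StatisticalMechanics
open Literature.Geometry.DiscreteGeometry
open Summit.AtomisticToContinuum.Crystallization.Theorems.FrustratedLawDichotomyLocalCloseOrderUniform (localCloseOrder_relDense)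

/-- Packing: a finite `7/10`-separated set inside a ball of radius `k` has at most `(3k+1)³` points. [folklore] -/
theorem card_le_of_sep_of_dist_le {s : Finset (EuclideanSpace ℝ (Fin 3))} {a : EuclideanSpace ℝ (Fin 3)} {k : ℕ}
    (hsep : ∀ c ∈ s, ∀ d ∈ s, c ≠ d → (7 : ℝ) / 10 ≤ dist c d) (hs : ∀ c ∈ s, dist c a ≤ k) :
    s.card ≤ (3 * k + 1) ^ 3 := by
  have h := card_le_of_separated_of_dist_le s a (by norm_num : (0 : ℝ) < 7 / 10) (Nat.cast_nonneg k) hs hsep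
  rw [finrank_euclideanSpace_fin] at h
  have h2 : (2 * (k : ℝ) / (7 / 10) + 1) ^ 3 ≤ ((3 * k + 1 : ℕ) : ℝ) ^ 3 := by
    push_cast
    apply pow_le_pow_left₀ (by positivity)
    have : (0 : ℝ) ≤ k := Nat.cast_nonneg k
    linarith
  exact_mod_cast h.trans h2

/-- **POSITIVE DENSITY OF CLOSE-PACKED SITES (under `LCO`).**  See the module docstring. [folklore] -/
theorem localCloseOrder_density
    (hLCO : ∀ X : Set (EuclideanSpace ℝ (Fin 3)), (0 : EuclideanSpace ℝ (Fin 3)) ∈ X → (∀ a ∈ X, ∀ b ∈ X, a ≠ b → (7 : ℝ) / 10 ≤ dist a b) → Literature.MathematicalPhysics.StatisticalMechanics.IsMuGSC Literature.MathematicalPhysics.StatisticalMechanics.lennardJones (⨅ Q : Literature.MathematicalPhysics.StatisticalMechanics.PeriodicConfiguration 3, Q.energyPerParticle Literature.MathematicalPhysics.StatisticalMechanics.lennardJones) X → ∃ p : EuclideanSpace ℝ (Fin 3), p ∈ X ∧ ∃ (d η γ : ℝ) (A : EuclideanSpace ℝ (Fin 3) →ₗᵢ[ℝ] EuclideanSpace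 ℝ (Fin 3)), (∃ t : ↥Literature.Geometry.DiscreteGeometry.fccKissingPattern → EuclideanSpace ℝ (Fin 3), 0 < d ∧ 0 < γ ∧ η < 1 / 20 ∧ (∀ u : ↥Literature.Geometry.DiscreteGeometry.fccKissingPattern, t u ∈ X ∧ ‖(t u - p) - d • A (u : EuclideanSpace ℝ (Fin 3))‖ ≤ η * d) ∧ (∀ s : EuclideanSpace ℝ (Fin 3), s ∈ X → s ≠ p → d ≤ dist s p) ∧ (∃ s : EuclideanSpace ℝ (Fin 3), s ∈ X ∧ s ≠ p ∧ dist s p ≤ d) ∧ (∀ s : EuclideanSpace ℝ (Fin 3), s ∈ X → s ≠ p → dist s p < 13 / 10 * d + γ → dist s p ≤ 13 / 10 * d - γ ∧ s ∈ Set.range t)) ∨ (∃ t : ↥Literature.Geometry.DiscreteGeometry.hcpKissingPattern → EuclideanSpace ℝ (Fin 3), 0 < d ∧ 0 < γ ∧ η < 1 / 20 ∧ (∀ u : ↥Literature.Geometry.DiscreteGeometry.hcpKissingPattern, t u ∈ X ∧ ‖(t u - p) - d • A (u : EuclideanSpace ℝ (Fin 3))‖ ≤ η * d) ∧ (∀ s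 : EuclideanSpace ℝ (Fin 3), s ∈ X → s ≠ p → d ≤ dist s p) ∧ (∃ s : EuclideanSpace ℝ (Fin 3), s ∈ X ∧ s ≠ p ∧ dist s p ≤ d) ∧ (∀ s : EuclideanSpace ℝ (Fin 3), s ∈ X → s ≠ p → dist s p < 13 / 10 * d + γ → dist s p ≤ 13 / 10 * d - γ ∧ s ∈ Set.range t))) :
    ∃ k : ℕ, ∀ X : Set (EuclideanSpace ℝ (Fin 3)), (∀ a ∈ X, ∀ b ∈ X, a ≠ b → (7 : ℝ) / 10 ≤ dist a b) → Literature.MathematicalPhysics.StatisticalMechanics.IsMuGSC Literature.MathematicalPhysics.StatisticalMechanics.lennardJones (⨅ Q : Literature.MathematicalPhysics.StatisticalMechanics.PeriodicConfiguration 3, Q.energyPerParticle Literature.MathematicalPhysics.StatisticalMechanics.lennardJones) X → ∀ s : Finset (EuclideanSpace ℝ (Fin 3)), (↑s : Set (EuclideanSpace ℝ (Fin 3))) ⊆ X → ∃ G : Finset (EuclideanSpace ℝ (Fin 3)), (s.card : ℝ) ≤ (((3 * k + 1) ^ 3 : ℕ) : ℝ) * G.card ∧ ∀ g ∈ G, g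 ∈ X ∧ (∃ q ∈ s, dist g q ≤ k) ∧ ∃ (d η γ : ℝ) (A : EuclideanSpace ℝ (Fin 3) →ₗᵢ[ℝ] EuclideanSpace ℝ (Fin 3)), η + 1 / ((k : ℝ) + 1) ≤ 1 / 20 ∧ 1 / ((k : ℝ) + 1) ≤ γ ∧ ((∃ t : ↥Literature.Geometry.DiscreteGeometry.fccKissingPattern → EuclideanSpace ℝ (Fin 3), 0 < d ∧ 0 < γ ∧ η < 1 / 20 ∧ (∀ u : ↥Literature.Geometry.DiscreteGeometry.fccKissingPattern, t u ∈ X ∧ ‖(t u - g) - d • A (u : EuclideanSpace ℝ (Fin 3))‖ ≤ η * d) ∧ (∀ s : EuclideanSpace ℝ (Fin 3), s ∈ X → s ≠ g → d ≤ dist s g) ∧ (∃ s : EuclideanSpace ℝ (Fin 3), s ∈ X ∧ s ≠ g ∧ dist s g ≤ d) ∧ (∀ s : EuclideanSpace ℝ (Fin 3), s ∈ X → s ≠ g → dist s g < 13 / 10 * d + γ → dist s g ≤ 13 / 10 * d - γ ∧ s ∈ Set.range t)) ∨ (∃ t : ↥Literature.Geometry.DiscreteGeometry.hcpKissingPattern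 → EuclideanSpace ℝ (Fin 3), 0 < d ∧ 0 < γ ∧ η < 1 / 20 ∧ (∀ u : ↥Literature.Geometry.DiscreteGeometry.hcpKissingPattern, t u ∈ X ∧ ‖(t u - g) - d • A (u : EuclideanSpace ℝ (Fin 3))‖ ≤ η * d) ∧ (∀ s : EuclideanSpace ℝ (Fin 3), s ∈ X → s ≠ g → d ≤ dist s g) ∧ (∃ s : EuclideanSpace ℝ (Fin 3), s ∈ X ∧ s ≠ g ∧ dist s g ≤ d) ∧ (∀ s : EuclideanSpace ℝ (Fin 3), s ∈ X → s ≠ g → dist s g < 13 / 10 * d + γ → dist s g ≤ 13 / 10 * d - γ ∧ s ∈ Set.range t))) := by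
  classical
  obtain ⟨k, hk⟩ := localCloseOrder_relDense hLCO
  refine ⟨k, fun X hsep hGSC s hsX => ?_⟩
  have hk' := hk X hsep hGSC
  -- a good atom within `k` of each atom of `X`
  choose f hfX hfd hfg using hk'
  set F : EuclideanSpace ℝ (Fin 3) → EuclideanSpace ℝ (Fin 3) := fun q => if hq : q ∈ X then f q hq else q with hF
  have hFq : ∀ q (hq : q ∈ X), F q = f q hq := fun q hq => by simp only [hF, dif_pos hq]
  refine ⟨s.image F, ?_, fun g hg => ?_⟩
  · -- fibres of `F` on `s` lie in a ball of radius `k` about their image: at most `(3k+1)³` atoms each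
    have hfib : ∀ b ∈ s.image F, (s.filter fun x => F x = b).card ≤ (3 * k + 1) ^ 3 := by
      intro b hb
      refine card_le_of_sep_of_dist_le (a := b) (fun c hc d hd hcd => hsep c (hsX (Finset.mem_filter.1 hc).1) d (hsX (Finset.mem_filter.1 hd).1) hcd)
        fun c hc => ?_
      obtain ⟨hcs, hcb⟩ := Finset.mem_filter.1 hc
      have hcX : c ∈ X := hsX hcs
      rw [← hcb, hFq c hcX, dist_comm]
      exact hfd c hcX
    have h := Finset.card_le_mul_card_image s ((3 * k + 1) ^ 3) hfib
    exact_mod_cast h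
  · obtain ⟨q, hqs, rfl⟩ := Finset.mem_image.1 hg
    have hqX : q ∈ X := hsX hqs
    rw [hFq q hqX]
    exact ⟨hfX q hqX, ⟨q, hqs, hfd q hqX⟩, hfg q hqX⟩

end Summit.AtomisticToContinuum.Crystallization.Theorems.FrustratedLawDichotomyLocalCloseOrderDensity

end
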